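import Summits.CriticalPhenomena.PercolationContinuityZ3.Theorems.Transplant.SkelPhiRunExitPieces
import Summits.CriticalPhenomena.PercolationContinuityZ3.Theorems.Transplant.SkelPhiApronKitDefs
import HarnessLib

/-!
# N1 (the `{±1}` node), LEVEL 1, kit adapter file N-K6c: AFFINE SIDE FORMS AND THE PLACEMENT INEQUALITIES — a side form is *affine of
# slope `U`* when `θ m' − θ m = (m' − m)·U`; for a family of affine forms with climbing coefficient `C ≥ n`, `U ≤ (kq+1)·n`, `|c_b| ≤ U`,
# `UL ≤ U`, the seven placement hypotheses of `kitClauseA'` (`hθA, hbelow, habove, hK, hKC, hAz, hcap`) follow from FOUR numeric inequalities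
# on the kit constants; plus the `U`-scaled raw side form `rawSideU` (so that ONE offset `A = (nz+1)·U + 1` serves raw and level sides alike),
# the families `runXSideU` / `runYSideU`, and the raw exit lemma for `rawSideU`

builds on p205010 (kernel theorem, internal audit signed; external expert review pending) — nothing in this file uses p205010; nothing here is a
claim about the open node `SamePDropOfSkeletonNeg`.
Lane `prim-bschramm`, seat `prim-bschramm-p1` (gen 11; design KIT-APRON-N1); helper file (`--supports stmt-CriticalPhenomena-4575 --as helper`).
* §1 `SideForm.IsAffine U C`; **`placement_of_affine`** (the seven hypotheses);
* §2 `rawSideU`, `rawSideU_isAffine`, `levSide_isAffine`, **`runXSideU`**, **`runYSideU`**, `runXSideU_isAffine`, `runYSideU_isAffine`,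
  `exit_rawSideU_sideHalf`.
[cite: KozmaNitzan2024, §4 Lemma 10, p. 20 (Step IV)] [cite: MartineauTassion2017, §3]
-/

noncomputable section

open scoped Classical

namespace Summit.CriticalPhenomena.PercolationContinuityZ3.Theorems.Transplant

namespace Skelφ

open Literature.Probability.Percolation Literature.Probability.LatticeModels SimpleGraph
open Literature.Probability.Percolation.KozmaNitzan.Cells (oth oth_ne eq_oth_of_ne oth_oth)

variable {V : Type} {G : SimpleGraph V} [G.LocallyFinite] {ψ φ : V → Site 2}

/-! ## §1 Affine side forms; the placement inequalities -/

/-- **An affine side form of slope `U`, climbing coefficient `C`**: `θ m' − θ m = (m' − m)·U`, `s·c_a = C`, `|c_b| ≤ U`, `UL ≤ U`. [this work] -/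
structure SideForm.IsAffine {Lo Hi : Site 2} {i : Fin 2} {σ₀ : ℤˣ} (F : SideForm ψ φ Lo Hi i σ₀) (U C : ℤ) : Prop where
  /-- affine thresholds -/
  θ_sub : ∀ m m' : ℤ, F.θ m' - F.θ m = (m' - m) * U
  /-- the climbing coefficient -/
  clim_eq : (F.s : ℤ) * coef F.cα F.cβ F.a = C
  /-- the transverse coefficient -/
  cb_le : |coef F.cα F.cβ (oth F.a)| ≤ U
  /-- the edge variation -/
  UL_le : (F.UL : ℤ) ≤ U

omit [G.LocallyFinite] in
/-- `|coef a| ≤ |c_α| + |c_β|`. [folklore] -/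
theorem abs_coef_le (cα cβ : ℤ) (a : Fin 2) : |coef cα cβ a| ≤ |cα| + |cβ| := by
  fin_cases a <;> simp [coef]

omit [G.LocallyFinite] in
/-- `toNat (x / C) ≤ K` from `x ≤ K·C` (`0 < C`). [folklore] -/
theorem toNat_ediv_le {x C : ℤ} {K : ℕ} (hC : 0 < C) (hx : x ≤ (K : ℤ) * C) : Int.toNat (x / C) ≤ K := by
  have h : x / C ≤ K := Int.ediv_le_of_le_mul hC hx
  omega

omit [G.LocallyFinite] in
/-- `toNat (−(x / C)) ≤ K` from `−K·C ≤ x` (`0 < C`). [folklore] -/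
theorem toNat_neg_ediv_le {x C : ℤ} {K : ℕ} (hC : 0 < C) (hx : -((K : ℤ) * C) ≤ x) : Int.toNat (-(x / C)) ≤ K := by
  have h : -(K : ℤ) ≤ x / C := Int.le_ediv_of_mul_le hC (by linarith)
  omega

section Placement

variable {Lo Hi : Site 2} (SF : ∀ (i : Fin 2) (σ : ℤˣ), SideForm ψ φ Lo Hi i σ) {U : ℤ} {C : Fin 2 → ℤˣ → ℤ}
  (haff : ∀ i σ, (SF i σ).IsAffine U (C i σ)) (hU1 : 1 ≤ U) (P : ApronPrm)

omit [G.LocallyFinite] in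
include haff in
/-- Affine thresholds, rearranged. [folklore] -/
theorem IsAffine.key (i : Fin 2) (σ : ℤˣ) (m m' : ℤ) : (SF i σ).θ m' = (SF i σ).θ m + (m' - m) * U := by
  have := (haff i σ).θ_sub m m'; linarith

omit [G.LocallyFinite] in
include haff in
/-- `|m·c_b| ≤ W·U` for `|m| ≤ W`. [folklore] -/
theorem IsAffine.mcb_le (i : Fin 2) (σ : ℤˣ) {m : ℤ} (h1 : -(P.W : ℤ) ≤ m) (h2 : m ≤ P.W) :
    |m * coef (SF i σ).cα (SF i σ).cβ (oth (SF i σ).a)| ≤ P.W * U := by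
  rw [abs_mul]; exact mul_le_mul (abs_le.2 ⟨h1, h2⟩) (haff i σ).cb_le (abs_nonneg _) (by positivity)

omit [G.LocallyFinite] in
include haff hU1 in
/-- **`hθA`** (`D ≥ d + 2`, `A ≥ 0`). [this work] -/
theorem hθA_of_affine (hA : 0 ≤ P.A) (hD : P.d + 2 ≤ shellD P) (i : Fin 2) (σ : ℤˣ) :
    (SF i σ).θ (2 + P.d) ≤ (SF i σ).θ (shellD P) + P.A := by
  rw [IsAffine.key SF haff i σ (2 + P.d) (shellD P)]
  have h1 : (0 : ℤ) ≤ ((shellD P : ℕ) : ℤ) - (2 + P.d) := by omega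
  nlinarith

omit [G.LocallyFinite] in
include haff hU1 in
/-- **`hbelow`** (`W + ℓ + d + 2 ≤ D`). [this work] -/
theorem hbelow_of_affine (hD1 : P.W + P.ℓ + P.d + 2 ≤ shellD P) (i : Fin 2) (σ : ℤˣ) (z : Site 2)
    (hz : (SF i σ).lin z < (SF i σ).θ (2 + P.d)) (m : ℤ) (hm1 : -(P.W : ℤ) ≤ m) (hm2 : m ≤ P.W) :
    (SF i σ).lin (apronPt z (SF i σ).a (SF i σ).s m 0) + P.ℓ * (SF i σ).UL < (SF i σ).θ (shellD P) := by
  rw [(SF i σ).lin_apronPt]; push_cast; rw [zero_mul, add_zero]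
  have h1 := IsAffine.mcb_le SF haff P i σ hm1 hm2; rw [abs_le] at h1
  rw [IsAffine.key SF haff i σ (2 + P.d) (shellD P)]
  have hU0 : (0 : ℤ) ≤ U := by linarith
  have h2 : ((P.W : ℤ) + P.ℓ) * U ≤ (((shellD P : ℕ) : ℤ) - (2 + P.d)) * U :=
    mul_le_mul_of_nonneg_right (by omega) hU0
  have h3 : (P.ℓ : ℤ) * (SF i σ).UL ≤ P.ℓ * U := mul_le_mul_of_nonneg_left (haff i σ).UL_le (by positivity)
  have e2 : ((P.W : ℤ) + P.ℓ) * U = P.W * U + P.ℓ * U := by ring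
  linarith [h1.2]

omit [G.LocallyFinite] in
include haff hU1 in
/-- **`habove`** (`W + ℓ ≤ d`). [this work] -/
theorem habove_of_affine (hd1 : P.W + P.ℓ ≤ P.d) (i : Fin 2) (σ : ℤˣ) (z : Site 2) (hz : (SF i σ).θ (1 + P.d) ≤ (SF i σ).lin z) (m : ℤ)
    (hm1 : -(P.W : ℤ) ≤ m) (hm2 : m ≤ P.W) : (SF i σ).θ 1 ≤ (SF i σ).lin (apronPt z (SF i σ).a (SF i σ).s m 0) - P.ℓ * (SF i σ).UL := by
  rw [(SF i σ).lin_apronPt]; push_cast; rw [zero_mul, add_zero]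
  have h1 := IsAffine.mcb_le SF haff P i σ hm1 hm2; rw [abs_le] at h1
  rw [IsAffine.key SF haff i σ (1 + P.d) 1]
  have hU0 : (0 : ℤ) ≤ U := by linarith
  have h2 : ((P.W : ℤ) + P.ℓ) * U ≤ (P.d : ℤ) * U := mul_le_mul_of_nonneg_right (by exact_mod_cast hd1) hU0
  have h3 : (P.ℓ : ℤ) * (SF i σ).UL ≤ P.ℓ * U := mul_le_mul_of_nonneg_left (haff i σ).UL_le (by positivity)
  have e2 : ((P.W : ℤ) + P.ℓ) * U = P.W * U + P.ℓ * U := by ring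
  have e3 : (1 - (1 + (P.d : ℤ))) * U = -(P.d * U) := by ring
  linarith [h1.1]

omit [G.LocallyFinite] in
include haff hU1 in
/-- **`hK`** (`Kmax ≥ (D + W)(kq + 1)`, `n ≤ C`, `U ≤ (kq+1)·n`). [this work] -/
theorem hK_of_affine {n kq Kmax : ℕ} (hn : 1 ≤ n) (hC : ∀ i σ, (n : ℤ) ≤ C i σ) (hU : U ≤ (kq + 1 : ℕ) * n)
    (hKmax : (shellD P + P.W) * (kq + 1) ≤ Kmax) (i : Fin 2) (σ : ℤˣ) (z : Site 2) (hz : (SF i σ).θ (1 + P.d) ≤ (SF i σ).lin z)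
    (m : ℤ) (hm1 : -(P.W : ℤ) ≤ m) (hm2 : m ≤ P.W) : (SF i σ).apronK z (shellD P) P.ℓ m ≤ Kmax := by
  have hn0 : (0 : ℤ) < n := by exact_mod_cast hn
  unfold SideForm.apronK
  refine toNat_ediv_le (SF i σ).clim_pos ?_
  rw [(haff i σ).clim_eq, (SF i σ).lin_apronPt]; push_cast; rw [zero_mul, add_zero]
  have h1 := IsAffine.mcb_le SF haff P i σ hm1 hm2; rw [abs_le] at h1
  rw [IsAffine.key SF haff i σ (1 + P.d) (shellD P)]
  have hKC : (((shellD P : ℕ) : ℤ) + P.W) * (((kq + 1 : ℕ) : ℤ) * n) ≤ (Kmax : ℤ) * C i σ := by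
    have e1 : (((shellD P + P.W) * (kq + 1) : ℕ) : ℤ) ≤ Kmax := by exact_mod_cast hKmax
    have := mul_le_mul e1 (hC i σ) hn0.le (by positivity)
    push_cast at this ⊢; linarith
  have h4 : (((shellD P : ℕ) : ℤ) + P.W) * U ≤ (((shellD P : ℕ) : ℤ) + P.W) * (((kq + 1 : ℕ) : ℤ) * n) :=
    mul_le_mul_of_nonneg_left hU (by positivity)
  have h5 : (0 : ℤ) ≤ (1 + P.d) * U := by nlinarith
  have h7 : (0 : ℤ) ≤ (P.ℓ : ℤ) * (SF i σ).UL := by positivity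
  have e4 : (((shellD P : ℕ) : ℤ) + P.W) * U = ((shellD P : ℕ) : ℤ) * U + P.W * U := by ring
  have e5 : (((shellD P : ℕ) : ℤ) - (1 + P.d)) * U = ((shellD P : ℕ) : ℤ) * U - (1 + P.d) * U := by ring
  linarith [h1.1]

omit [G.LocallyFinite] in
include haff hU1 in
/-- **`hKC`** (`KCmax ≥ (D + nz + 1)(kq + 1)`, `A = (nz+1)U + 1`). [this work] -/
theorem hKC_of_affine {n kq nz KCmax : ℕ} (hn : 1 ≤ n) (hC : ∀ i σ, (n : ℤ) ≤ C i σ) (hU : U ≤ (kq + 1 : ℕ) * n)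
    (hA : P.A = (nz + 1 : ℕ) * U + 1) (hKCmax : (shellD P + nz + 1) * (kq + 1) ≤ KCmax) (i : Fin 2) (σ : ℤˣ) (z : Site 2)
    (hz1 : (SF i σ).θ (1 + P.d) ≤ (SF i σ).lin z) : (SF i σ).kitK z (shellD P) P.A ≤ KCmax := by
  have hn0 : (0 : ℤ) < n := by exact_mod_cast hn
  unfold SideForm.kitK
  refine toNat_neg_ediv_le (SF i σ).clim_pos ?_
  rw [(haff i σ).clim_eq]
  rw [IsAffine.key SF haff i σ (1 + P.d) (shellD P), hA]
  have hKC : (((shellD P : ℕ) : ℤ) + nz + 1) * (((kq + 1 : ℕ) : ℤ) * n) ≤ (KCmax : ℤ) * C i σ := by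
    have e1 : (((shellD P + nz + 1) * (kq + 1) : ℕ) : ℤ) ≤ KCmax := by exact_mod_cast hKCmax
    have := mul_le_mul e1 (hC i σ) hn0.le (by positivity)
    push_cast at this ⊢; linarith
  have h4 : (((shellD P : ℕ) : ℤ) + nz + 1) * U ≤ (((shellD P : ℕ) : ℤ) + nz + 1) * (((kq + 1 : ℕ) : ℤ) * n) :=
    mul_le_mul_of_nonneg_left hU (by positivity)
  have h5 : (0 : ℤ) ≤ (P.d : ℤ) * U := by nlinarith
  push_cast
  have e4 : (((shellD P : ℕ) : ℤ) + nz + 1) * U = ((shellD P : ℕ) : ℤ) * U + nz * U + U := by ring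
  have e5 : (((shellD P : ℕ) : ℤ) - (1 + P.d)) * U = ((shellD P : ℕ) : ℤ) * U - U - P.d * U := by ring
  have e6 : ((nz : ℤ) + 1) * U = nz * U + U := by ring
  linarith

omit [G.LocallyFinite] in
include haff in
/-- **`hAz`** (`A = (nz+1)U + 1`). [this work] -/
theorem hAz_of_affine {nz : ℕ} (hA : P.A = (nz + 1 : ℕ) * U + 1) (i : Fin 2) (σ : ℤˣ) : ((nz + 1 : ℕ) : ℤ) * (SF i σ).UL + 1 ≤ P.A := by
  rw [hA]
  have := mul_le_mul_of_nonneg_left (haff i σ).UL_le (show (0 : ℤ) ≤ ((nz + 1 : ℕ) : ℤ) by positivity)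
  linarith

omit [G.LocallyFinite] in
include haff hU1 in
/-- **`hcap`** (`ℓ + Rs + d + 3 ≤ D`). [this work] -/
theorem hcap_of_affine {Rs : ℕ} (hD2 : P.ℓ + Rs + P.d + 3 ≤ shellD P) (i : Fin 2) (σ : ℤˣ) (z : Site 2)
    (hz : (SF i σ).lin z < (SF i σ).θ (2 + P.d)) :
    (P.ℓ : ℤ) * ((SF i σ).s * coef (SF i σ).cα (SF i σ).cβ (SF i σ).a) + (Rs : ℤ) * |coef (SF i σ).cα (SF i σ).cβ (oth (SF i σ).a)| +
      (SF i σ).UL ≤ (SF i σ).θ (shellD P) - (SF i σ).lin z := by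
  rw [(haff i σ).clim_eq, IsAffine.key SF haff i σ (2 + P.d) (shellD P)]
  have hU0 : (0 : ℤ) ≤ U := by linarith
  have h1 : (Rs : ℤ) * |coef (SF i σ).cα (SF i σ).cβ (oth (SF i σ).a)| ≤ Rs * U := mul_le_mul_of_nonneg_left (haff i σ).cb_le (by positivity)
  have hCU : C i σ ≤ U := by
    rw [← (haff i σ).clim_eq]
    refine le_trans ?_ (haff i σ).UL_le
    rw [SideForm.UL_eq]
    have hs : |((SF i σ).s : ℤ)| = 1 := by rcases Int.units_eq_one_or (SF i σ).s with h | h <;> simp [h]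
    have h0 := le_abs_self (((SF i σ).s : ℤ) * coef (SF i σ).cα (SF i σ).cβ (SF i σ).a)
    rw [abs_mul, hs, one_mul] at h0
    exact h0.trans (abs_coef_le _ _ _)
  have h3 : (P.ℓ : ℤ) * C i σ ≤ P.ℓ * U := mul_le_mul_of_nonneg_left hCU (by positivity)
  have h4 : ((P.ℓ : ℤ) + Rs + 1) * U ≤ (((shellD P : ℕ) : ℤ) - (2 + P.d)) * U := mul_le_mul_of_nonneg_right (by omega) hU0
  have h5 := (haff i σ).UL_le
  have e4 : ((P.ℓ : ℤ) + Rs + 1) * U = P.ℓ * U + Rs * U + U := by ring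
  linarith [h1, h3, h4, h5, hz, e4]

end Placement

/-! ## §2 The `U`-scaled raw side form; the affine families of the run frames -/

/-- **The `U`-scaled raw side form**: `L = −σ₀σU·α`, `θ m = U·(m ∓ face − σ₀σα₀)` (`1 ≤ U`). [this work] -/
def rawSideU (ψ : V → Site 2) (c₀ : V) (σ : ℤ) (hσ : σ = 1 ∨ σ = -1) {U : ℤ} (hU : 1 ≤ U) (Lo Hi : Site 2) (i : Fin 2) (σ₀ : ℤˣ)
    (hraw : ∀ w, ψ w i = σ * (φ w 0 - φ c₀ 0)) : SideForm ψ φ Lo Hi i σ₀ where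
  cα := -((σ₀ : ℤ) * σ) * U
  cβ := 0
  θ := fun m => (m + (if (σ₀ : ℤ) = 1 then -Hi i else Lo i) - (σ₀ : ℤ) * σ * φ c₀ 0) * U
  a := 0
  s := -(σ₀ * sgnU σ)
  clim := by
    have hs := val_sgnU hσ
    have h1 : (σ₀ : ℤ) * (σ₀ : ℤ) = 1 := by rcases Int.units_eq_one_or σ₀ with h | h <;> simp [h]
    have h2 : σ * σ = 1 := by rcases hσ with rfl | rfl <;> simp
    have hc : coef (-((σ₀ : ℤ) * σ) * U) 0 0 = -((σ₀ : ℤ) * σ) * U := by simp [coef]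
    have e : (((-(σ₀ * sgnU σ)) : ℤˣ) : ℤ) * coef (-((σ₀ : ℤ) * σ) * U) 0 0 = ((σ₀ : ℤ) * (σ₀ : ℤ)) * (σ * σ) * U := by
      rw [hc, Units.val_neg, Units.val_mul, hs]; ring
    rw [e, h1, h2]; linarith
  depth_iff := by
    intro v m
    have hx := hraw v
    have hU0 : 0 < U := by linarith
    unfold sdepth linForm
    rw [hx]
    rcases Int.units_eq_one_or σ₀ with h1 | h1 <;> subst h1
    · rw [if_pos Units.val_one, if_pos Units.val_one, Units.val_one]
      constructor
      · intro hh; nlinarith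
      · intro hh
        by_contra hc; push Not at hc
        have : (Hi i - σ * (φ v 0 - φ c₀ 0) + 1 - m) * U ≤ 0 := by nlinarith
        nlinarith
    · have hne : ¬ (((-1 : ℤˣ) : ℤ) = 1) := by simp
      rw [if_neg hne, if_neg hne, Units.val_neg, Units.val_one]
      constructor
      · intro hh; nlinarith
      · intro hh
        by_contra hc; push Not at hc
        nlinarith

omit [G.LocallyFinite] in
/-- The scaled raw form is affine of slope `U`, coefficient `U`. [folklore] -/
theorem rawSideU_isAffine (c₀ : V) (σ : ℤ) (hσ : σ = 1 ∨ σ = -1) {U : ℤ} (hU : 1 ≤ U) (Lo Hi : Site 2) (i : Fin 2) (σ₀ : ℤˣ)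
    (hraw : ∀ w, ψ w i = σ * (φ w 0 - φ c₀ 0)) : (rawSideU ψ c₀ σ hσ hU Lo Hi i σ₀ hraw).IsAffine U U := by
  have hs := val_sgnU hσ
  have h1 : (σ₀ : ℤ) * (σ₀ : ℤ) = 1 := by rcases Int.units_eq_one_or σ₀ with h | h <;> simp [h]
  have h2 : σ * σ = 1 := by rcases hσ with rfl | rfl <;> simp
  have he1 : |(σ₀ : ℤ) * σ| = 1 := by rcases Int.units_eq_one_or σ₀ with h | h <;> rcases hσ with h' | h' <;> simp [h, h']
  refine ⟨fun m m' => by simp only [rawSideU]; ring, ?_, ?_, ?_⟩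
  · have hc : coef (-((σ₀ : ℤ) * σ) * U) 0 0 = -((σ₀ : ℤ) * σ) * U := by simp [coef]
    show (((-(σ₀ * sgnU σ)) : ℤˣ) : ℤ) * coef (-((σ₀ : ℤ) * σ) * U) 0 0 = U
    rw [hc, Units.val_neg, Units.val_mul, hs]; linear_combination U * ((σ * σ) * h1 + h2)
  · show |coef (-((σ₀ : ℤ) * σ) * U) 0 (oth 0)| ≤ U
    simp [coef, oth]; linarith
  · rw [SideForm.UL_eq]
    show |-((σ₀ : ℤ) * σ) * U| + |(0 : ℤ)| ≤ U
    rw [abs_zero, add_zero, abs_mul, abs_neg, he1, one_mul, abs_of_pos (by linarith)]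

omit [G.LocallyFinite] in
/-- The level form is affine of slope `U = n + |h|`, coefficient `n`. [folklore] -/
theorem levSide_isAffine (c₀ : V) {n : ℕ} (hn : 1 ≤ n) (h σ : ℤ) (hσ : σ = 1 ∨ σ = -1) (Lo Hi : Site 2) (i : Fin 2) (σ₀ : ℤˣ)
    (hlev : ∀ w, ψ w i = (σ * shearCoord φ c₀ n h w) / (shearUnit n h : ℤ)) :
    (levSide ψ c₀ hn h σ hσ Lo Hi i σ₀ hlev).IsAffine (shearUnit n h : ℤ) n := by
  have he1 : |(σ₀ : ℤ) * σ| = 1 := by rcases Int.units_eq_one_or σ₀ with h | h <;> rcases hσ with h' | h' <;> simp [h, h']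
  have hU : ((shearUnit n h : ℕ) : ℤ) = n + |h| := by unfold shearUnit; push_cast; rfl
  refine ⟨fun m m' => ?_, levSide_C (φ := φ) c₀ hn h σ hσ Lo Hi i σ₀ hlev, ?_, ?_⟩
  · simp only [levSide]; split_ifs <;> ring
  · show |coef ((σ₀ : ℤ) * σ * h) (-((σ₀ : ℤ) * σ * n)) (oth 1)| ≤ (shearUnit n h : ℤ)
    have hc : coef ((σ₀ : ℤ) * σ * h) (-((σ₀ : ℤ) * σ * n)) (oth 1) = (σ₀ : ℤ) * σ * h := by simp [coef, oth]
    rw [hc, abs_mul ((σ₀ : ℤ) * σ) h, he1, one_mul, hU]; linarith [abs_nonneg h, Int.natCast_nonneg n]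
  · rw [SideForm.UL_eq, hU]
    show |(σ₀ : ℤ) * σ * h| + |-((σ₀ : ℤ) * σ * n)| ≤ n + |h|
    rw [abs_neg, abs_mul ((σ₀ : ℤ) * σ) h, abs_mul ((σ₀ : ℤ) * σ) (n : ℤ), he1, one_mul, one_mul, Nat.abs_cast]; linarith

/-- **The four side forms of a box of the x-run frame, raw sides `U`-scaled.** [this work] -/
def runXSideU (c₀ : V) {n : ℕ} (hn : 1 ≤ n) (h : ℤ) {σ : ℤ} (hσ : σ = 1 ∨ σ = -1) (Lo Hi : Site 2) :
    ∀ (i : Fin 2) (σ₀ : ℤˣ), SideForm (runX φ c₀ n h σ) φ Lo Hi i σ₀ := fun i σ₀ =>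
  if hi : i = 0 then hi ▸ rawSideU (runX φ c₀ n h σ) c₀ σ hσ (U := (shearUnit n h : ℤ)) (by have := shearUnit_pos hn h; omega) Lo Hi 0 σ₀
      (fun w => by rw [runX_zero, relCoord_apply])
  else (eq_oth_of_ne hi : i = oth 0) ▸ levSide (runX φ c₀ n h σ) c₀ hn h σ hσ Lo Hi 1 σ₀ (fun w => by rw [runX_one])

/-- **The four side forms of a box of the y′-run frame, raw sides `U`-scaled.** [this work] -/
def runYSideU (c₀ : V) {n : ℕ} (hn : 1 ≤ n) (h : ℤ) {σ : ℤ} (hσ : σ = 1 ∨ σ = -1) (Lo Hi : Site 2) :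
    ∀ (i : Fin 2) (σ₀ : ℤˣ), SideForm (runY φ c₀ n h σ) φ Lo Hi i σ₀ := fun i σ₀ =>
  if hi : i = 0 then hi ▸ levSide (runY φ c₀ n h σ) c₀ hn h σ hσ Lo Hi 0 σ₀ (fun w => by rw [runY_zero])
  else (eq_oth_of_ne hi : i = oth 0) ▸ rawSideU (runY φ c₀ n h σ) c₀ σ hσ (U := (shearUnit n h : ℤ)) (by have := shearUnit_pos hn h; omega)
      Lo Hi 1 σ₀ (fun w => by rw [runY_one, relCoord_apply])

/-- The x-run side forms are affine of slope `U`, coefficients `U` (raw) / `n` (level). [folklore] -/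
theorem runXSideU_isAffine (c₀ : V) {n : ℕ} (hn : 1 ≤ n) (h : ℤ) {σ : ℤ} (hσ : σ = 1 ∨ σ = -1) (Lo Hi : Site 2) (i : Fin 2) (σ₀ : ℤˣ) :
    (runXSideU (φ := φ) c₀ hn h hσ Lo Hi i σ₀).IsAffine (shearUnit n h : ℤ) (if i = 0 then (shearUnit n h : ℤ) else n) := by
  have hU1 : (1 : ℤ) ≤ (shearUnit n h : ℤ) := by have := shearUnit_pos hn h; omega
  fin_cases i <;> simp only [Fin.zero_eta, Fin.isValue, Fin.mk_one, if_true, show ¬ ((1 : Fin 2) = 0) by decide, if_false]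
  · exact rawSideU_isAffine (ψ := runX φ c₀ n h σ) c₀ σ hσ hU1 Lo Hi 0 σ₀ (fun w => by rw [runX_zero, relCoord_apply])
  · exact levSide_isAffine (ψ := runX φ c₀ n h σ) c₀ hn h σ hσ Lo Hi 1 σ₀ (fun w => by rw [runX_one])

/-- The y′-run side forms are affine of slope `U`, coefficients `n` (level) / `U` (raw). [folklore] -/
theorem runYSideU_isAffine (c₀ : V) {n : ℕ} (hn : 1 ≤ n) (h : ℤ) {σ : ℤ} (hσ : σ = 1 ∨ σ = -1) (Lo Hi : Site 2) (i : Fin 2) (σ₀ : ℤˣ) :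
    (runYSideU (φ := φ) c₀ hn h hσ Lo Hi i σ₀).IsAffine (shearUnit n h : ℤ) (if i = 0 then (n : ℤ) else (shearUnit n h : ℤ)) := by
  have hU1 : (1 : ℤ) ≤ (shearUnit n h : ℤ) := by have := shearUnit_pos hn h; omega
  fin_cases i <;> simp only [Fin.zero_eta, Fin.isValue, Fin.mk_one, if_true, show ¬ ((1 : Fin 2) = 0) by decide, if_false]
  · exact levSide_isAffine (ψ := runY φ c₀ n h σ) c₀ hn h σ hσ Lo Hi 0 σ₀ (fun w => by rw [runY_zero])
  · exact rawSideU_isAffine (ψ := runY φ c₀ n h σ) c₀ σ hσ hU1 Lo Hi 1 σ₀ (fun w => by rw [runY_one, relCoord_apply])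

/-- **RAW-SIDE EXIT for the scaled form**: the outward short side half `pgSideHalfW c n_s h_s ℓ_s R (σ₀σ) τ` satisfies `L(φ w) + A + C ≤ L(φ c)`
as soon as `A + U ≤ U·n_s`. [cite: MartineauTassion2017, §3.2] -/
theorem exit_rawSideU_sideHalf (c₀ : V) (σ : ℤ) (hσ : σ = 1 ∨ σ = -1) {U : ℤ} (hU : 1 ≤ U) (Lo Hi : Site 2) (i : Fin 2) (σ₀ : ℤˣ)
    (hraw : ∀ w, ψ w i = σ * (φ w 0 - φ c₀ 0)) {nS ℓS R : ℕ} {hS : ℤ} {A : ℤ} (hA : A + U ≤ U * nS) {c w : V} {τ : ℤ}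
    (hw : w ∈ pgSideHalfW G φ c nS hS ℓS R ((σ₀ : ℤ) * σ) τ) :
    (rawSideU ψ c₀ σ hσ hU Lo Hi i σ₀ hraw).lin (φ w) + A +
        ((rawSideU ψ c₀ σ hσ hU Lo Hi i σ₀ hraw).s : ℤ) * coef (rawSideU ψ c₀ σ hσ hU Lo Hi i σ₀ hraw).cα
          (rawSideU ψ c₀ σ hσ hU Lo Hi i σ₀ hraw).cβ (rawSideU ψ c₀ σ hσ hU Lo Hi i σ₀ hraw).a ≤
      (rawSideU ψ c₀ σ hσ hU Lo Hi i σ₀ hraw).lin (φ c) := by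
  rw [(rawSideU_isAffine c₀ σ hσ hU Lo Hi i σ₀ hraw).clim_eq]
  have hd : (rawSideU ψ c₀ σ hσ hU Lo Hi i σ₀ hraw).lin (φ w) - (rawSideU ψ c₀ σ hσ hU Lo Hi i σ₀ hraw).lin (φ c) =
      -((σ₀ : ℤ) * σ) * U * relCoord φ c 0 w := by
    simp only [SideForm.lin, rawSideU, linForm, relCoord_apply]; ring
  obtain ⟨-, -, hα, -⟩ := (mem_pgSideHalfW G φ).1 hw
  rw [hα] at hd
  have h1 : (σ₀ : ℤ) * (σ₀ : ℤ) = 1 := by rcases Int.units_eq_one_or σ₀ with h | h <;> simp [h]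
  have h2 : σ * σ = 1 := by rcases hσ with rfl | rfl <;> simp
  have e : -((σ₀ : ℤ) * σ) * U * ((σ₀ : ℤ) * σ * nS) = -(((σ₀ : ℤ) * (σ₀ : ℤ)) * (σ * σ)) * (U * nS) := by ring
  rw [e, h1, h2] at hd
  linarith

end Skelφ

end Summit.CriticalPhenomena.PercolationContinuityZ3.Theorems.Transplant

end
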